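import Literature.MathematicalPhysics.QuantumLattice.SectorisedIncrementBoundDBPlateau
import Literature.MathematicalPhysics.QuantumLattice.SectorisedEffectiveActionBoundWeightedPlateau
import Literature.MathematicalPhysics.QuantumLattice.GrassmannWeightedGaussConvBinomialGramPrescribed
import HarnessLib

/-!
# The FIRST ORDER of the sectorised single-scale increment in binomial–Gram form, DECAY-WEIGHTED (tree weights on the leg positions),
# plateau transport

Topic `MathematicalPhysics/QuantumLattice`; the weighted twin of `SectorisedIncrementBoundDBPlateau` §1/§2, first order
(`hubbardSectorKernelNorm_gaussConv_sub_le_binomial_of_gramBounded_of_plateau`): the linear part `e^{Δ_C} G − G` of one Gaussian step across a (single- or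
multi-slice) covariance, kernel by kernel — only the HIGHER kernels of the input, self-contracted, coefficient `C(2m′, 2p)·κ^{2m′−2p}`, NO row/column sums of the
slice — now with an `IsTreeWeight` weight on the OUTPUT positions and the `wt`-weighted pinned sums of the INPUT in the engine's currency
`kernel (map (toLin' E(F)) G)` (Benfatto–Giuliani–Mastropietro 2006 (2.61)–(2.63), (2.66) at first order, §3 (3.2)–(3.8): a self-contraction does not move
positions, so the weight of the output label set is at most that of the input label set — `IsTreeWeight.mono`).  The abstract supplier is the `J = ∅` case
of `GrassmannWeightedGaussConvBinomialGramPrescribed.sum_wt_norm_kernel_gaussConv_sub_le_binomial_prescribed_of_gramBounded`, spelled out here as the (so far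
untyped) weighted twin of `GrassmannGaussConvBinomialGram`:

* §0 **`sum_wt_norm_kernel_gaussConv_sub_le_binomial_of_gramBounded_wt`** (generic labels, no prescription) —
  `Σ_{W_i = w} wt(W)·‖kernel_{2p}(e^{Δ_C}H − H)(W)‖ ≤ Σ_{m′ > p} C(2m′,2p)·κ^{2m′−2p}·N(m′)`, `N(m′)` the `wt`-weighted pinned sums of `kernel_{2m′} H`;
* §1 **`sum_wt_norm_kernel_map_gaussConv_sub_le_binomial_of_gramBounded`** — the same read through `(f, g)` (auxiliary fields at `π′`, output labels at `π″`,
  weighted Young costs `(cr, cc)` of `g ∘ f`): `≤ cr·cc^{2p−1}·Σ_{m′>p} C(2m′,2p) κ^{2m′−2p} N(m′)`;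
* §2 **`sum_wt_norm_sectorAnalysis_gaussConv_sub_le_binomial_of_plateau`** (Hubbard torus) — thin/fat input families `F, F̃`, output family `F′`, plateau
  of `F` over `supp C` and `supp F′`, even `G`, sectorised covariance replica-Gram-bounded (`κ ≥ 0`), weighted input sizes
  `Σ_{Y_j = w} wt(πY)·‖kernel (map (toLin' E(F)) G) (2m′) Y‖ ≤ B m′`, weighted overlap costs `(cr, cc)`:
  `Σ_{X″_q = w″} wt(π″X″)·‖kernel (map (toLin' E(F′)) (e^{Δ_C}G − G)) (2p) X″‖ ≤ cr·cc^{2p−1}·Σ_{m′>p} C(2m′,2p) κ^{2m′−2p} ε_x^{2m′} B m′`.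

With `SectorisedIncrementBoundGradedWeightedPlateau` (orders `≥ 2`) this is the complete WEIGHTED block step `(Hstep)` of the birth-level tower in the
engine's currency (cell gate-hubbard-kl, K3 engine child, clause (E1)).  Everything is proved; no definition, no named fact.

## Sources

G. Benfatto, A. Giuliani, V. Mastropietro, Ann. Henri Poincaré 7 (2006) 809–898, (2.61)–(2.63), (2.66), (2.70)–(2.71a), (2.76)–(2.80), §3 (3.2)–(3.8)
[`BenfattoGiulianiMastropietro2006`]; K. Gawȩdzki, A. Kupiainen, Comm. Math. Phys. 102 (1985) 1–30, §3 [`GawedzkiKupiainen1985GrossNeveu`].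
-/

noncomputable section

namespace Literature.MathematicalPhysics.QuantumLattice

open GrassmannAlgebra Finset Literature.Probability.LatticeModels Literature.Probability.LatticeModels.BattleFederbush
open scoped Nat

universe u

/-! ### §0 Generic labels, no prescription: the weighted twin of the binomial–Gram first order -/

section Abstract

variable {𝕜 : Type*} [RCLike 𝕜] {Γ : Type u} [Fintype Γ] [DecidableEq Γ] {wt : Finset Γ → ℝ}

/-- `(2p)!⁻¹ · Π_{j < 2p} (2m′ − j) = C(2m′, 2p)` (cast to `ℝ`). [folklore] -/
private theorem factorial_inv_mul_prod_sub_eq_choose (p m' : ℕ) :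
    (((2 * p).factorial : ℝ))⁻¹ * ((∏ j : Fin (2 * p), (2 * m' - (j : ℕ)) : ℕ) : ℝ) = ((2 * m').choose (2 * p) : ℝ) := by
  have hfac : ((2 * p).factorial : ℝ) ≠ 0 := by positivity
  rw [Fin.prod_univ_eq_prod_range (fun j => 2 * m' - j) (2 * p), ← Nat.descFactorial_eq_prod_range,
    Nat.descFactorial_eq_factorial_mul_choose, Nat.cast_mul, ← mul_assoc, inv_mul_cancel₀ hfac, one_mul]

/-- **The linear part of the RG map in binomial–Gram form, DECAY-WEIGHTED, no prescription** (BGM 2006 (2.61)–(2.63), (2.66), (2.77)–(2.80), §3 (3.2)–(3.8);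
the `J = ∅` case of `sum_wt_norm_kernel_gaussConv_sub_le_binomial_prescribed_of_gramBounded`): `H` even, `C` replica-Gram-bounded (`κ ≥ 0`), `wt` a tree weight,
`N(m′)` the `wt`-weighted pinned sums of `kernel_{2m′} H`; then for `p`, one output leg pinned,
`Σ_{W_i = w} wt(W)·‖kernel_{2p}(e^{Δ_C}H − H)(W)‖ ≤ Σ_{m′ ≤ |Γ|/2, p < m′} C(2m′, 2p)·κ^{2m′−2p}·N(m′)`. [cite: BenfattoGiulianiMastropietro2006, (2.61)-(2.63), (2.66), (3.2)-(3.8)] -/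
theorem sum_wt_norm_kernel_gaussConv_sub_le_binomial_of_gramBounded_wt (C : Matrix Γ Γ 𝕜) (hwt : IsTreeWeight wt) {κ : ℝ} (hκ : 0 ≤ κ)
    (hGB : IsGramBoundedR C κ) (H : GrassmannAlgebra 𝕜 Γ) (hH : H ∈ evenPart 𝕜 Γ) {p : ℕ} (N : ℕ → ℝ) (hN0 : ∀ m', 0 ≤ N m')
    (hN : ∀ (m' : ℕ) (t : Fin (2 * m')) (a : Γ), ∑ Y ∈ univ.filter (fun Y : Fin (2 * m') → Γ => Y t = a),
      ‖kernel 𝕜 H (2 * m') Y‖ * wt (univ.image Y) ≤ N m')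
    (i : Fin (2 * p)) (w : Γ) :
    ∑ W ∈ univ.filter (fun W : Fin (2 * p) → Γ => W i = w), wt (univ.image W) * ‖kernel 𝕜 (gaussConv 𝕜 C H - H) (2 * p) W‖ ≤
      ∑ m' ∈ range (Fintype.card Γ / 2 + 1), if p < m' then ((2 * m').choose (2 * p) : ℝ) * κ ^ (2 * m' - 2 * p) * N m' else 0 := by
  have h := sum_wt_norm_kernel_gaussConv_sub_le_binomial_prescribed_of_gramBounded C hwt hκ hGB H hH (p := p) ∅ (fun _ _ => true)
    (fun m' _ => N m') (fun m' _ => hN0 m')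
    (by
      intro m' T _ ι _ t _ a
      refine le_of_eq_of_le (sum_congr rfl fun Y _ => ?_) (hN m' t a)
      rw [prod_eq_one fun j _ => by simp, mul_one])
    i (Finset.notMem_empty i) w
  have hfilter : univ.filter (fun W : Fin (2 * p) → Γ => W i = w ∧ ∀ j ∈ (∅ : Finset (Fin (2 * p))), (fun (_ : Fin (2 * p)) (_ : Γ) => true) j (W j) = true) =
      univ.filter (fun W : Fin (2 * p) → Γ => W i = w) := filter_congr fun W _ => by simp
  rw [hfilter] at h
  refine h.trans (le_of_eq (sum_congr rfl fun m' _ => ?_))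
  split_ifs with hm
  · rw [filter_true_of_mem fun j _ => Finset.notMem_empty j, card_empty, pow_zero, mul_one, factorial_inv_mul_prod_sub_eq_choose]
  · rfl

end Abstract

/-! ### §1 Generic label sets: read through `(f, g)` -/

section Generic

variable {𝕜 : Type*} [RCLike 𝕜] {Γ Γ' Γ'' : Type u} {Λ : Type*} [Fintype Γ] [DecidableEq Γ] [Fintype Γ'] [DecidableEq Γ']
  [Fintype Γ''] [DecidableEq Γ''] [DecidableEq Λ] {wt : Finset Λ → ℝ}

/-- **First order of the increment, read through `(f, g)`, binomial–Gram form, DECAY-WEIGHTED** (BGM 2006 (2.61)–(2.63), (2.66) at first order with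
(2.70)–(2.71a), §3 (3.2)–(3.8)): `Ṽ` even with `wt∘π′`-weighted pinned sums `≤ N(m′)`, `C′ = fᵀ C f` replica-Gram-bounded (`κ ≥ 0`), weighted costs `(cr, cc)` of the
matrix of `g ∘ f`; then for every `p ≥ 1`, one output leg pinned at `w″`,
`Σ_{X″_q = w″} wt(π″X″)·‖kernel_{2p} (map g (e^{Δ_C}(map f Ṽ) − map f Ṽ))(X″)‖ ≤ cr·cc^{2p−1}·Σ_{m′ ≤ |Γ′|/2, p < m′} C(2m′,2p) κ^{2m′−2p} N(m′)`.
[cite: BenfattoGiulianiMastropietro2006, (2.61)-(2.63), (2.66), (3.2)-(3.8)] -/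
theorem sum_wt_norm_kernel_map_gaussConv_sub_le_binomial_of_gramBounded (hwt : IsTreeWeight wt) (π' : Γ' → Λ) (π'' : Γ'' → Λ)
    (C : Matrix Γ Γ 𝕜) (f : (Γ' → 𝕜) →ₗ[𝕜] (Γ → 𝕜)) (g : (Γ → 𝕜) →ₗ[𝕜] (Γ'' → 𝕜))
    (Vt : GrassmannAlgebra 𝕜 Γ') (hVt : Vt ∈ evenPart 𝕜 Γ')
    {κ : ℝ} (hκ : 0 ≤ κ) (hGB : IsGramBoundedR ((LinearMap.toMatrix' f).transpose * C * LinearMap.toMatrix' f) κ)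
    (N : ℕ → ℝ) (hN0 : ∀ m', 0 ≤ N m')
    (hN : ∀ (m' : ℕ) (j : Fin (2 * m')) (w : Γ'), ∑ Y ∈ univ.filter (fun Y : Fin (2 * m') → Γ' => Y j = w),
      ‖kernel 𝕜 Vt (2 * m') Y‖ * wt ((univ.image Y).image π') ≤ N m')
    {cr cc : ℝ} (hcc0 : 0 ≤ cc)
    (hrow' : ∀ X'', ∑ X', ‖(LinearMap.toMatrix' g * LinearMap.toMatrix' f) X'' X'‖ * wt {π'' X'', π' X'} ≤ cr)
    (hcol' : ∀ X', ∑ X'', ‖(LinearMap.toMatrix' g * LinearMap.toMatrix' f) X'' X'‖ * wt {π'' X'', π' X'} ≤ cc)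
    (p : ℕ) (q : Fin (2 * (p + 1))) (w'' : Γ'') :
    ∑ X'' ∈ univ.filter (fun X'' : Fin (2 * (p + 1)) → Γ'' => X'' q = w''), wt ((univ.image X'').image π'') *
        ‖kernel 𝕜 (ExteriorAlgebra.map g (gaussConv 𝕜 C (ExteriorAlgebra.map f Vt) - ExteriorAlgebra.map f Vt)) (2 * (p + 1)) X''‖ ≤
      cr * cc ^ (2 * p + 1) *
        ∑ m' ∈ range (Fintype.card Γ' / 2 + 1),
          (if p + 1 < m' then ((2 * m').choose (2 * (p + 1)) : ℝ) * κ ^ (2 * m' - 2 * (p + 1)) * N m' else 0) := by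
  set C' : Matrix Γ' Γ' 𝕜 := (LinearMap.toMatrix' f).transpose * C * LinearMap.toMatrix' f with hC'
  -- the weight pulled back to the auxiliary labels is a tree weight
  set wt' : Finset Γ' → ℝ := fun S => wt (S.image π') with hwt'
  have hwt'tree : IsTreeWeight wt' := hwt.comap π'
  set B : ℝ := ∑ m' ∈ range (Fintype.card Γ' / 2 + 1),
    (if p + 1 < m' then ((2 * m').choose (2 * (p + 1)) : ℝ) * κ ^ (2 * m' - 2 * (p + 1)) * N m' else 0) with hB
  have hB0 : 0 ≤ B := sum_nonneg fun m' _ => by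
    split_ifs
    · exact mul_nonneg (mul_nonneg (Nat.cast_nonneg _) (pow_nonneg hκ _)) (hN0 m')
    · exact le_rfl
  -- the weighted first-order bound in the auxiliary representation, degree `2(p+1) = (2p+1)+1`
  have haux : ∀ (t : Fin (2 * p + 1 + 1)) (x : Γ'), ∑ X ∈ univ.filter (fun X : Fin (2 * p + 1 + 1) → Γ' => X t = x),
      ‖kernel 𝕜 (gaussConv 𝕜 C' Vt - Vt) (2 * p + 1 + 1) X‖ * wt ((univ.image X).image π') ≤ B := by
    intro t x
    have h := sum_wt_norm_kernel_gaussConv_sub_le_binomial_of_gramBounded_wt C' hwt'tree hκ hGB Vt hVt (p := p + 1) N hN0 hN t x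
    refine le_of_eq_of_le (sum_congr rfl fun X _ => mul_comm _ _) ?_
    exact h
  -- read through `g ∘ f` by the weighted Young inequality
  have hsub : gaussConv 𝕜 C (ExteriorAlgebra.map f Vt) - ExteriorAlgebra.map f Vt = ExteriorAlgebra.map f (gaussConv 𝕜 C' Vt - Vt) := by
    rw [gaussConv_map, map_sub]
  show ∑ X'' ∈ univ.filter (fun X'' : Fin (2 * p + 1 + 1) → Γ'' => X'' q = w''), wt ((univ.image X'').image π'') *
      ‖kernel 𝕜 (ExteriorAlgebra.map g (gaussConv 𝕜 C (ExteriorAlgebra.map f Vt) - ExteriorAlgebra.map f Vt)) (2 * p + 1 + 1) X''‖ ≤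
    cr * cc ^ (2 * p + 1) * B
  rw [hsub, map_map_eq_map_comp]
  exact sum_filter_wt_norm_kernel_map_le hwt π' π'' (g ∘ₗ f) hcc0
    (by intro X''; rw [LinearMap.toMatrix'_comp]; exact hrow' X'')
    (by intro X'; simp only [LinearMap.toMatrix'_comp]; exact hcol' X') (gaussConv 𝕜 C' Vt - Vt) (2 * p + 1) hB0 haux q w''

end Generic

/-! ### §2 The Hubbard torus: plateau transfer in the engine's weighted currency -/

section Transfer

variable {L M : ℕ} [NeZero L] [NeZero M] {N N' : ℕ} {Λ : Type*} [DecidableEq Λ] {wt : Finset Λ → ℝ}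

/-- **The FIRST-ORDER increment of the sectorised kernels across one slice, binomial–Gram form, DECAY-WEIGHTED** (BGM 2006 (2.61)–(2.63), (2.66), first order, in the
(2.70)–(2.71a) sector currency with the decay bookkeeping of §3 (3.2)–(3.8)).  Data: a tree weight `wt` on `Finset Λ`, position maps `π` (input sector-field labels),
`π″` (output labels); thin/fat input families `F, F̃` (`F̃F = F`, `ΣF = 0 ⇒ F = 0`), output family `F′`, plateau of `F` over `supp C` and over `F′`; ANY even
input `G`; the sectorised covariance `S(F̃)ᵀ C S(F̃)` replica-Gram-bounded with constant `κ ≥ 0`; WEIGHTED input sizes in the engine's currency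
`Σ_{Y_j = w} wt(πY)·‖kernel (map (toLin' E(F)) G) (2m′) Y‖ ≤ B m′`; weighted overlap costs `(cr, cc)` of `E(F′)S(F̃)`.  Then for every `p ≥ 1`, one output leg pinned,
`Σ_{X″_q = w″} wt(π″X″)·‖kernel (map (toLin' E(F′)) (e^{Δ_C}G − G)) (2p) X″‖ ≤ cr·cc^{2p−1}·Σ_{m′ > p} C(2m′,2p)·κ^{2m′−2p}·(ε_x^{2m′}·B m′)` — only the HIGHER kernels of `G`,
self-contracted; no row/column sums of the slice; the output weight at most the input's (`IsTreeWeight.mono`: self-contraction does not move positions).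
[cite: BenfattoGiulianiMastropietro2006, (2.61)-(2.63), (2.66), (3.2)-(3.8)] -/
theorem sum_wt_norm_sectorAnalysis_gaussConv_sub_le_binomial_of_plateau
    (hwt : IsTreeWeight wt) (π : SpaceTimeIdx L M × SectorLeg N → Λ) (π'' : SpaceTimeIdx L M × SectorLeg N' → Λ)
    {β : ℝ} (hβ : 0 < β) (F Ft : Fin N → FreqMomentum L M → ℂ) (hFF : ∀ ω k, Ft ω k * F ω k = F ω k)
    (hF0 : ∀ k, ∑ ω, F ω k = 0 → ∀ ω, F ω k = 0)
    (F' : Fin N' → FreqMomentum L M → ℂ) (G : HubbardGrassmann L M) (hG : G ∈ evenPart ℂ (HubbardFieldIdx L M))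
    (C : Matrix (HubbardFieldIdx L M) (HubbardFieldIdx L M) ℂ)
    (hCpl : ∀ X Y, C X Y ≠ 0 → ∑ ω, F ω X.1.1 = 1 ∧ ∑ ω, F ω Y.1.1 = 1)
    (hF'pl : ∀ (ω' : Fin N') (k : FreqMomentum L M), F' ω' k ≠ 0 → ∑ ω, F ω k = 1)
    {κ : ℝ} (hκ : 0 ≤ κ)
    (hGB : IsGramBoundedR ((sectorSubMatrix L M β Ft).transpose * C * sectorSubMatrix L M β Ft) κ)
    (B : ℕ → ℝ) (hB0 : ∀ m', 0 ≤ B m')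
    (hB : ∀ (m' : ℕ) (j : Fin (2 * m')) (w : SpaceTimeIdx L M × SectorLeg N),
      ∑ Y ∈ univ.filter (fun Y : Fin (2 * m') → SpaceTimeIdx L M × SectorLeg N => Y j = w),
        wt ((univ.image Y).image π) * ‖kernel ℂ (ExteriorAlgebra.map (Matrix.toLin' (sectorAnalysisMatrix L M β F)) G) (2 * m') Y‖ ≤
          B m')
    {cr cc : ℝ} (hcc0 : 0 ≤ cc)
    (hrow' : ∀ X'', ∑ X', ‖(sectorAnalysisMatrix L M β F' * sectorSubMatrix L M β Ft) X'' X'‖ * wt {π'' X'', π X'} ≤ cr)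
    (hcol' : ∀ X', ∑ X'', ‖(sectorAnalysisMatrix L M β F' * sectorSubMatrix L M β Ft) X'' X'‖ * wt {π'' X'', π X'} ≤ cc)
    (p : ℕ) (q : Fin (2 * (p + 1))) (w'' : SpaceTimeIdx L M × SectorLeg N') :
    ∑ X'' ∈ univ.filter (fun X'' : Fin (2 * (p + 1)) → SpaceTimeIdx L M × SectorLeg N' => X'' q = w''),
        wt ((univ.image X'').image π'') *
          ‖kernel ℂ (ExteriorAlgebra.map (Matrix.toLin' (sectorAnalysisMatrix L M β F')) (gaussConv ℂ C G - G)) (2 * (p + 1)) X''‖ ≤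
      cr * cc ^ (2 * p + 1) *
        ∑ m' ∈ range (Fintype.card (SpaceTimeIdx L M × SectorLeg N) / 2 + 1),
          (if p + 1 < m' then ((2 * m').choose (2 * (p + 1)) : ℝ) * κ ^ (2 * m' - 2 * (p + 1)) *
            (imagTimeWeight β M ^ (2 * m') * B m') else 0) := by
  have hε : 0 ≤ imagTimeWeight β M := imagTimeWeight_nonneg hβ.le M
  -- the weighted pinned sums of the preimage's kernels, in the engine's currency
  have hwl : ∀ S : Finset (SpaceTimeIdx L M × SectorLeg N), 0 ≤ wt (S.image π) := fun S => zero_le_one.trans (hwt.one_le _)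
  have hN : ∀ (m' : ℕ) (j : Fin (2 * m')) (w : SpaceTimeIdx L M × SectorLeg N),
      ∑ Y ∈ univ.filter (fun Y : Fin (2 * m') → SpaceTimeIdx L M × SectorLeg N => Y j = w),
        ‖kernel ℂ (sectorPreimage β F G) (2 * m') Y‖ * wt ((univ.image Y).image π) ≤ imagTimeWeight β M ^ (2 * m') * B m' :=
    fun m' j w => sum_wt_norm_kernel_sectorPreimage_le hβ.le F G (fun S => wt (S.image π)) hwl (hB0 m') (hB m') j w
  have hN0 : ∀ m', 0 ≤ imagTimeWeight β M ^ (2 * m') * B m' := fun m' => mul_nonneg (pow_nonneg hε _) (hB0 m')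
  -- transfer from `map S Ṽ` to `G` (plateau identities)
  have hid := map_sectorAnalysis_map_sectorPreimage_of_plateau hβ.ne' F Ft hFF hF0 F' G hF'pl
  have hgc := map_sectorAnalysis_gaussConv_map_sectorPreimage_of_plateau hβ.ne' F Ft hFF hF0 F' G C hCpl hF'pl
  have hrepl : ExteriorAlgebra.map (Matrix.toLin' (sectorAnalysisMatrix L M β F')) (gaussConv ℂ C G - G) =
      ExteriorAlgebra.map (Matrix.toLin' (sectorAnalysisMatrix L M β F'))
        (gaussConv ℂ C (ExteriorAlgebra.map (Matrix.toLin' (sectorSubMatrix L M β Ft)) (sectorPreimage β F G)) -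
          ExteriorAlgebra.map (Matrix.toLin' (sectorSubMatrix L M β Ft)) (sectorPreimage β F G)) := by
    rw [map_sub, map_sub, hid, hgc]
  rw [hrepl]
  exact sum_wt_norm_kernel_map_gaussConv_sub_le_binomial_of_gramBounded hwt π π'' C (Matrix.toLin' (sectorSubMatrix L M β Ft))
    (Matrix.toLin' (sectorAnalysisMatrix L M β F')) (sectorPreimage β F G) (sectorPreimage_mem_evenPart β F hG) hκ
    (by simpa only [LinearMap.toMatrix'_toLin'] using hGB) (fun m' => imagTimeWeight β M ^ (2 * m') * B m') hN0 hN hcc0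
    (by simpa only [LinearMap.toMatrix'_toLin'] using hrow') (by simpa only [LinearMap.toMatrix'_toLin'] using hcol') p q w''

end Transfer

end Literature.MathematicalPhysics.QuantumLattice

end
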